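import Summits.KontsevichZagierPeriods.KontsevichZagierPeriods.Theorems.SymplecticScissorsRealOnePeriodRelationsStubEllRealise
import Summits.KontsevichZagierPeriods.KontsevichZagierPeriods.Theorems.SymplecticScissorsRealOnePeriodRelationsStubEllTail

/-!
# `RealOnePeriodRelations` (stmt-KontsevichZagierPeriods-10042), line `nash-retraction-thin-strip`,
# the loop layer: stub `stub_branchRealise`

RULE 2 ALONG THE TWO HALVES OF THE REAL BRANCH.  In the loop layer the complete integral over the
unbounded real branch, a representation `r` on `{z | e < z 0}` (`e` real algebraic), is realised by a
closed loop whose underlying real parametrisation has abscissa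
`x(t) = e + t²(1 − t)²/(t − ½)²` on `(0,1) ∖ {½}`: `x` is a strictly increasing bijection
`(0, ½) → (e, ∞)` and a strictly decreasing bijection `(½, 1) → (e, ∞)`, with derivative
`x′(t) = t(1 − t)(1 − 2t)(t² − t + ½)/(t − ½)⁴` (positive on the first half, negative on the
second).  The realisation `R` lives on `(0,1)` with integrand `½ r(x(t)) x′(t)` on `(0, ½)` and
`½ r(x(t)) (−x′(t))` on `(½, 1)`.  This file proves `[r] − [R] ∈ M₁`:

* rule 1a: split `R` at `t = ½` into its restrictions `R₁`, `R₂` to `(0, ½)`, `(½, 1)` (the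
  remainder `{½}` is a null coordinate hyperplane), `HomotopyInvariance.of_sub_sub_mem_of_cover`;
* rule 2: push each half forward along the `ℚ`-semialgebraic injective chart `x(·)`
  (`helper_cells_1`); both push-forwards have domain `{z | e < z 0}` (intermediate value theorem:
  `x → e` at `0⁺`, `x → +∞` at `½⁻`, and the symmetry `x(1 − t) = x(t)`) and integrand `½ r` there
  (`|x′|` cancels);
* rule 1b: `r = ½ r + ½ r` on `{z | e < z 0}` (`KZ.integrandAddRel`).

References: M. Kontsevich, D. Zagier, *Periods* (2001), §1.2 rules (1), (2); A. Huber,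
G. Wüstholz, *Transcendence and linear relations of 1-periods* (2022), §13.2.
-/

noncomputable section

open Set MeasureTheory Filter Topology
open Literature.NumberTheory.Transcendental Literature.ModelTheory.ExponentialFields
open Summit.KontsevichZagierPeriods.SymplecticScissors.RealOnePeriodRelationsNegative (M₁ H₁)

namespace Summit.KontsevichZagierPeriods.SymplecticScissors.RealOnePeriodRelations.LoopLayer

/-! ## Calculus of the branch chart `x(t) = e + t²(1 − t)²/(t − ½)²` -/

/-- The branch chart `x(t) = e + t²(1 − t)²/(t − ½)²` has derivative
`t(1 − t)(1 − 2t)(t² − t + ½)/(t − ½)⁴` at every `t ≠ ½`. [folklore] -/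
theorem hasDerivAt_branchChart (e : ℝ) {t : ℝ} (ht : t ≠ 1 / 2) :
    HasDerivAt (fun t : ℝ => e + (t * (1 - t)) ^ 2 / (t - 1 / 2) ^ 2)
      (t * (1 - t) * (1 - 2 * t) * (t ^ 2 - t + 1 / 2) / (t - 1 / 2) ^ 4) t := by
  have hv : t - 1 / 2 ≠ 0 := sub_ne_zero.2 ht
  have h1 : HasDerivAt (fun t : ℝ => t * (1 - t)) (1 * (1 - t) + t * (0 - 1)) t :=
    (hasDerivAt_id' t).fun_mul ((hasDerivAt_const t (1 : ℝ)).fun_sub (hasDerivAt_id' t))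
  have h2 : HasDerivAt (fun t : ℝ => (t * (1 - t)) ^ 2) (2 * (t * (1 - t)) * (1 - 2 * t)) t :=
    (h1.fun_pow 2).congr_deriv (by simp only [Nat.cast_ofNat, Nat.reduceSub, pow_one]; ring)
  have h3 : HasDerivAt (fun t : ℝ => (t - 1 / 2) ^ 2) (2 * (t - 1 / 2)) t :=
    (((hasDerivAt_id' t).sub_const (1 / 2 : ℝ)).fun_pow 2).congr_deriv
      (by simp only [Nat.cast_ofNat, Nat.reduceSub, pow_one, mul_one])
  refine ((h2.fun_div h3 (pow_ne_zero 2 hv)).const_add e).congr_deriv ?_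
  rw [div_eq_div_iff (pow_ne_zero 2 (pow_ne_zero 2 hv)) (pow_ne_zero 4 hv)]
  ring

/-- `t² − t + ½ = (t − ½)² + ¼ > 0`. [folklore] -/
theorem branchChart_aux_pos (t : ℝ) : 0 < t ^ 2 - t + 1 / 2 := by
  nlinarith [sq_nonneg (t - 1 / 2)]

/-- The derivative of the branch chart is positive on `(0, ½)`. [folklore] -/
theorem branchChart_deriv_pos {t : ℝ} (ht : t ∈ Ioo (0 : ℝ) (1 / 2)) :
    0 < t * (1 - t) * (1 - 2 * t) * (t ^ 2 - t + 1 / 2) / (t - 1 / 2) ^ 4 := by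
  have h4 : 0 < (t - 1 / 2) ^ 4 := Even.pow_pos (by decide) (sub_ne_zero.2 ht.2.ne)
  exact div_pos (mul_pos (mul_pos (mul_pos ht.1 (by linarith [ht.2])) (by linarith [ht.2]))
    (branchChart_aux_pos t)) h4

/-- The derivative of the branch chart is negative on `(½, 1)`. [folklore] -/
theorem branchChart_deriv_neg {t : ℝ} (ht : t ∈ Ioo (1 / 2 : ℝ) 1) :
    t * (1 - t) * (1 - 2 * t) * (t ^ 2 - t + 1 / 2) / (t - 1 / 2) ^ 4 < 0 := by
  have h4 : 0 < (t - 1 / 2) ^ 4 := Even.pow_pos (by decide) (sub_ne_zero.2 ht.1.ne')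
  refine div_neg_of_neg_of_pos (mul_neg_of_neg_of_pos (mul_neg_of_pos_of_neg
    (mul_pos (by linarith [ht.1]) (by linarith [ht.2])) (by linarith [ht.1])) (branchChart_aux_pos t)) h4

/-- The branch chart exceeds `e` on `(0,1) ∖ {½}`. [folklore] -/
theorem branchChart_gt (e : ℝ) {t : ℝ} (ht : t ∈ Ioo (0 : ℝ) 1) (h : t ≠ 1 / 2) :
    e < e + (t * (1 - t)) ^ 2 / (t - 1 / 2) ^ 2 :=
  lt_add_of_pos_right e (div_pos (pow_pos (mul_pos ht.1 (sub_pos.2 ht.2)) 2)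
    (Even.pow_pos even_two (sub_ne_zero.2 h)))

/-- The branch chart is continuous on every set avoiding `½`. [folklore] -/
theorem continuousOn_branchChart (e : ℝ) {s : Set ℝ} (hs : ∀ t ∈ s, t ≠ 1 / 2) :
    ContinuousOn (fun t : ℝ => e + (t * (1 - t)) ^ 2 / (t - 1 / 2) ^ 2) s :=
  fun t ht => (hasDerivAt_branchChart e (hs t ht)).continuousAt.continuousWithinAt

/-- The branch chart is strictly increasing on `(0, ½)`. [folklore] -/
theorem strictMonoOn_branchChart (e : ℝ) :
    StrictMonoOn (fun t : ℝ => e + (t * (1 - t)) ^ 2 / (t - 1 / 2) ^ 2) (Ioo 0 (1 / 2)) := by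
  refine strictMonoOn_of_deriv_pos (convex_Ioo 0 (1 / 2))
    (continuousOn_branchChart e fun t ht => ht.2.ne) fun t ht => ?_
  rw [interior_Ioo] at ht
  rw [(hasDerivAt_branchChart e ht.2.ne).deriv]
  exact branchChart_deriv_pos ht

/-- The branch chart is strictly decreasing on `(½, 1)`. [folklore] -/
theorem strictAntiOn_branchChart (e : ℝ) :
    StrictAntiOn (fun t : ℝ => e + (t * (1 - t)) ^ 2 / (t - 1 / 2) ^ 2) (Ioo (1 / 2) 1) := by
  refine strictAntiOn_of_deriv_neg (convex_Ioo (1 / 2) 1)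
    (continuousOn_branchChart e fun t ht => ht.1.ne') fun t ht => ?_
  rw [interior_Ioo] at ht
  rw [(hasDerivAt_branchChart e ht.1.ne').deriv]
  exact branchChart_deriv_neg ht

/-- The symmetry `x(1 − t) = x(t)` of the branch chart. [folklore] -/
theorem branchChart_symm (e t : ℝ) :
    e + ((1 - t) * (1 - (1 - t))) ^ 2 / (1 - t - 1 / 2) ^ 2 = e + (t * (1 - t)) ^ 2 / (t - 1 / 2) ^ 2 := by
  have h1 : (1 - t) * (1 - (1 - t)) = t * (1 - t) := by ring
  have h2 : (1 - t - 1 / 2) ^ 2 = (t - 1 / 2) ^ 2 := by ring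
  rw [h1, h2]

/-- The branch chart maps `(0, ½)` ONTO `(e, ∞)`: it is continuous there, tends to `e` at `0⁺` and
to `+∞` at `½⁻` (intermediate value theorem). [folklore] -/
theorem exists_branchChart_eq (e : ℝ) {u : ℝ} (hu : e < u) :
    ∃ t ∈ Ioo (0 : ℝ) (1 / 2), e + (t * (1 - t)) ^ 2 / (t - 1 / 2) ^ 2 = u := by
  have h := IsPreconnected.intermediate_value_Ioi (isPreconnected_Ioo (a := (0 : ℝ)) (b := 1 / 2))
    (l₁ := 𝓝[>] (0 : ℝ)) (l₂ := 𝓝[<] (1 / 2 : ℝ))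
    (le_principal_iff.2 (Ioo_mem_nhdsGT (by norm_num)))
    (le_principal_iff.2 (Ioo_mem_nhdsLT (by norm_num)))
    (continuousOn_branchChart e fun t ht => ht.2.ne) (v := e) ?_ ?_
  · exact h hu
  · -- `x → e` at `0⁺`
    have hc : ContinuousAt (fun t : ℝ => e + (t * (1 - t)) ^ 2 / (t - 1 / 2) ^ 2) 0 :=
      (hasDerivAt_branchChart e (by norm_num : (0 : ℝ) ≠ 1 / 2)).continuousAt
    have h0 : Tendsto (fun t : ℝ => e + (t * (1 - t)) ^ 2 / (t - 1 / 2) ^ 2) (𝓝 0) (𝓝 e) := by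
      simpa using hc.tendsto
    exact h0.mono_left nhdsWithin_le_nhds
  · -- `x → +∞` at `½⁻`
    refine tendsto_atTop_add_const_left _ e ?_
    have hnum : Tendsto (fun t : ℝ => (t * (1 - t)) ^ 2) (𝓝[<] (1 / 2 : ℝ))
        (𝓝 (((1 / 2 : ℝ) * (1 - 1 / 2)) ^ 2)) := by
      have hc : Continuous (fun t : ℝ => (t * (1 - t)) ^ 2) := by fun_prop
      exact (hc.tendsto (1 / 2 : ℝ)).mono_left nhdsWithin_le_nhds
    have hden : Tendsto (fun t : ℝ => (t - 1 / 2) ^ 2) (𝓝[<] (1 / 2 : ℝ)) (𝓝[>] 0) := by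
      rw [tendsto_nhdsWithin_iff]
      constructor
      · have hc : Continuous (fun t : ℝ => (t - 1 / 2) ^ 2) := by fun_prop
        have h0 : Tendsto (fun t : ℝ => (t - 1 / 2) ^ 2) (𝓝 (1 / 2 : ℝ)) (𝓝 0) := by
          simpa using hc.tendsto (1 / 2 : ℝ)
        exact h0.mono_left nhdsWithin_le_nhds
      · exact eventually_nhdsWithin_of_forall fun t ht =>
          mem_Ioi.2 (Even.pow_pos even_two (sub_ne_zero.2 (ne_of_lt ht)))
    have key : Tendsto (fun t : ℝ => (t * (1 - t)) ^ 2 * ((t - 1 / 2) ^ 2)⁻¹) (𝓝[<] (1 / 2 : ℝ))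
        atTop := hnum.pos_mul_atTop (by norm_num) hden.inv_tendsto_nhdsGT_zero
    refine key.congr fun t => ?_
    ring

/-- The branch chart maps `(½, 1)` ONTO `(e, ∞)` (symmetry `t ↦ 1 − t`). [folklore] -/
theorem exists_branchChart_eq' (e : ℝ) {u : ℝ} (hu : e < u) :
    ∃ t ∈ Ioo (1 / 2 : ℝ) 1, e + (t * (1 - t)) ^ 2 / (t - 1 / 2) ^ 2 = u := by
  obtain ⟨t, ht, htu⟩ := exists_branchChart_eq e hu
  refine ⟨1 - t, ⟨by linarith [ht.2], by linarith [ht.1]⟩, ?_⟩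
  rw [branchChart_symm]
  exact htu

/-! ## Semialgebraicity of the chart and of its derivative -/

/-- The branch chart is a `ℚ`-semialgebraic function of `p 0` on every `ℚ`-semialgebraic set
(a rational function with the algebraic coefficient `e`). [cite: BochnakCosteRoy1998, Prop. 2.2.6] -/
theorem isSemialgebraicFunOn_branchChart {s : Set (Fin 1 → ℝ)} (hs : IsSemialgebraic ℚ s) {e : ℝ}
    (he : IsAlgebraic ℚ e) :
    IsSemialgebraicFunOn ℚ s (fun p => e + (p 0 * (1 - p 0)) ^ 2 / (p 0 - 1 / 2) ^ 2) := by
  have h0 : IsSemialgebraicFunOn ℚ s (fun p : Fin 1 → ℝ => p 0) := isSemialgebraicFunOn_apply hs 0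
  have h1 : IsSemialgebraicFunOn ℚ s (fun _ => (1 : ℝ)) :=
    isSemialgebraicFunOn_const_of_isAlgebraic hs isAlgebraic_one
  have hh : IsSemialgebraicFunOn ℚ s (fun _ => (1 / 2 : ℝ)) :=
    isSemialgebraicFunOn_const_of_isAlgebraic hs (by rw [one_div]; exact (isAlgebraic_nat 2).inv)
  have he' : IsSemialgebraicFunOn ℚ s (fun _ => e) := isSemialgebraicFunOn_const_of_isAlgebraic hs he
  exact (he'.fun_add (((h0.fun_mul (h1.fun_sub h0)).fun_pow 2).fun_mul
    ((h0.fun_sub hh).fun_pow 2).fun_inv)).congr fun p _ => by simp only [div_eq_mul_inv]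

/-- The derivative of the branch chart is a `ℚ`-semialgebraic function of `p 0` on every
`ℚ`-semialgebraic set (a rational function with rational coefficients). [cite: BochnakCosteRoy1998, Prop. 2.2.6] -/
theorem isSemialgebraicFunOn_branchChart_deriv {s : Set (Fin 1 → ℝ)} (hs : IsSemialgebraic ℚ s) :
    IsSemialgebraicFunOn ℚ s (fun p => p 0 * (1 - p 0) * (1 - 2 * p 0) * (p 0 ^ 2 - p 0 + 1 / 2) /
      (p 0 - 1 / 2) ^ 4) := by
  have h0 : IsSemialgebraicFunOn ℚ s (fun p : Fin 1 → ℝ => p 0) := isSemialgebraicFunOn_apply hs 0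
  have h1 : IsSemialgebraicFunOn ℚ s (fun _ => (1 : ℝ)) :=
    isSemialgebraicFunOn_const_of_isAlgebraic hs isAlgebraic_one
  have h2 : IsSemialgebraicFunOn ℚ s (fun _ => (2 : ℝ)) := isSemialgebraicFunOn_const_ofNat hs 2
  have hh : IsSemialgebraicFunOn ℚ s (fun _ => (1 / 2 : ℝ)) :=
    isSemialgebraicFunOn_const_of_isAlgebraic hs (by rw [one_div]; exact (isAlgebraic_nat 2).inv)
  exact ((((h0.fun_mul (h1.fun_sub h0)).fun_mul (h1.fun_sub (h2.fun_mul h0))).fun_mul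
    (((h0.fun_pow 2).fun_sub h0).fun_add hh)).fun_mul ((h0.fun_sub hh).fun_pow 4).fun_inv).congr
    fun p _ => (div_eq_mul_inv _ _).symm

/-- `{z | z 0 < ½} ⊂ ℝ¹` is `ℚ`-semialgebraic. [folklore] -/
theorem branchChart_isSemialgebraic_lt_half : IsSemialgebraic ℚ {z : Fin 1 → ℝ | z 0 < 1 / 2} := by
  have hf : IsSemialgebraicFunOn ℚ (univ : Set (Fin 1 → ℝ)) (fun z => z 0 - 1 / 2) :=
    (isSemialgebraicFunOn_apply isSemialgebraic_univ 0).fun_sub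
      (isSemialgebraicFunOn_const_of_isAlgebraic isSemialgebraic_univ
        (by rw [one_div]; exact (isAlgebraic_nat 2).inv))
  convert hf.isSemialgebraic_sep_neg using 1
  ext z
  simp [sub_neg]

/-- `{z | ½ < z 0} ⊂ ℝ¹` is `ℚ`-semialgebraic. [folklore] -/
theorem branchChart_isSemialgebraic_half_lt : IsSemialgebraic ℚ {z : Fin 1 → ℝ | 1 / 2 < z 0} := by
  have hf : IsSemialgebraicFunOn ℚ (univ : Set (Fin 1 → ℝ)) (fun z => 1 / 2 - z 0) :=
    (isSemialgebraicFunOn_const_of_isAlgebraic isSemialgebraic_univ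
      (by rw [one_div]; exact (isAlgebraic_nat 2).inv)).fun_sub
      (isSemialgebraicFunOn_apply isSemialgebraic_univ 0)
  convert hf.isSemialgebraic_sep_neg using 1
  ext z
  simp [sub_neg]

/-! ## Rule 2 along one half of the branch chart -/

/-- **One half of the branch.**  If `R'` lives on `{z | z 0 ∈ I}` with `I` avoiding `½`, the branch
chart `x(·)` is injective on `I` with nowhere-zero derivative, maps `I` onto `(e, ∞)`, and the
integrand of `R'` is `½ r(x(t)) |x′(t)|` on `I`, then the push-forward of `R'` along `x(·)` (rule 2,
`helper_cells_1`) is a representation `s` on `r.domain = {z | e < z 0}` with integrand `½ r` there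
and `[R'] − [s] ∈ M₁`. [cite: KontsevichZagier2001, §1.2 rule (2)] -/
theorem branchRealise_half {e : ℝ} (he : IsAlgebraic ℚ e) (r R' : KZ.IntegralRep 1) (I : Set ℝ)
    (hr : r.domain = {z | e < z 0}) (hmem : ∀ p : Fin 1 → ℝ, p ∈ R'.domain ↔ p 0 ∈ I)
    (hI : ∀ t ∈ I, t ≠ 1 / 2)
    (hne : ∀ t ∈ I, t * (1 - t) * (1 - 2 * t) * (t ^ 2 - t + 1 / 2) / (t - 1 / 2) ^ 4 ≠ 0)
    (hinj : InjOn (fun t : ℝ => e + (t * (1 - t)) ^ 2 / (t - 1 / 2) ^ 2) I)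
    (hgt : ∀ t ∈ I, e < e + (t * (1 - t)) ^ 2 / (t - 1 / 2) ^ 2)
    (hsurj : ∀ u : ℝ, e < u → ∃ t ∈ I, e + (t * (1 - t)) ^ 2 / (t - 1 / 2) ^ 2 = u)
    (hint : ∀ t ∈ I, R'.integrand (fun _ => t) =
      1 / 2 * r.integrand (fun _ => e + (t * (1 - t)) ^ 2 / (t - 1 / 2) ^ 2) *
        |t * (1 - t) * (1 - 2 * t) * (t ^ 2 - t + 1 / 2) / (t - 1 / 2) ^ 4|) :
    ∃ s : KZ.IntegralRep 1, s.domain = r.domain ∧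
      (∀ z ∈ r.domain, s.integrand z = 1 / 2 * r.integrand z) ∧ KZ.of R' - KZ.of s ∈ M₁ := by
  -- the chart and its derivative, as opaque functions with their defining equations
  obtain ⟨φ, hφ⟩ : ∃ φ : ℝ → ℝ, ∀ t, φ t = e + (t * (1 - t)) ^ 2 / (t - 1 / 2) ^ 2 :=
    ⟨_, fun _ => rfl⟩
  obtain ⟨φ', hφ'⟩ : ∃ φ' : ℝ → ℝ, ∀ t,
      φ' t = t * (1 - t) * (1 - 2 * t) * (t ^ 2 - t + 1 / 2) / (t - 1 / 2) ^ 4 := ⟨_, fun _ => rfl⟩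
  have hφfun : φ = fun t => e + (t * (1 - t)) ^ 2 / (t - 1 / 2) ^ 2 := funext hφ
  have hσ := R'.isSemialgebraic_domain
  have hφs : IsSemialgebraicFunOn ℚ R'.domain (fun p => φ (p 0)) :=
    (isSemialgebraicFunOn_branchChart hσ he).congr fun p _ => (hφ (p 0)).symm
  have hφ's : IsSemialgebraicFunOn ℚ R'.domain (fun p => φ' (p 0)) :=
    (isSemialgebraicFunOn_branchChart_deriv hσ).congr fun p _ => (hφ' (p 0)).symm
  have hder : ∀ p ∈ R'.domain, HasDerivAt φ (φ' (p 0)) (p 0) := fun p hp => by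
    rw [hφfun, hφ']
    exact hasDerivAt_branchChart e (hI _ ((hmem p).1 hp))
  have hne' : ∀ p ∈ R'.domain, φ' (p 0) ≠ 0 := fun p hp => by
    rw [hφ']
    exact hne _ ((hmem p).1 hp)
  have hgtφ : ∀ t ∈ I, e < φ t := fun t ht => by
    rw [hφ]
    exact hgt t ht
  have hsurjφ : ∀ u : ℝ, e < u → ∃ t ∈ I, φ t = u := fun u hu => by
    simp only [hφ]
    exact hsurj u hu
  have hinjφ : InjOn φ I := by
    rw [hφfun]
    exact hinj
  have hinj' : InjOn (fun p : Fin 1 → ℝ => fun _ : Fin 1 => φ (p 0)) R'.domain := by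
    intro p hp p' hp' h
    have h0 : φ (p 0) = φ (p' 0) := congrFun h 0
    have : p 0 = p' 0 := hinjφ ((hmem p).1 hp) ((hmem p').1 hp') h0
    rw [KZ.eq_const_apply_zero p, KZ.eq_const_apply_zero p', this]
  -- rule 2: push `R'` forward along the chart
  obtain ⟨s, hsdom, hsi, hrel⟩ := helper_cells_1 R' φ φ' hφs hφ's hder hne' hinj'
  -- the push-forward has the domain of `r` …
  have hsr : s.domain = r.domain := by
    rw [hsdom, hr]
    ext z
    constructor
    · rintro ⟨p, hp, rfl⟩
      exact hgtφ _ ((hmem p).1 hp)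
    · intro hz
      obtain ⟨t, ht, htz⟩ := hsurjφ _ hz
      refine ⟨fun _ => t, (hmem _).2 ht, ?_⟩
      rw [KZ.eq_const_apply_zero z]
      funext
      exact htz
  -- … and, on it, the integrand `½ r`
  refine ⟨s, hsr, fun z hz => ?_, hrel⟩
  have hz' : e < z 0 := by
    rw [hr] at hz
    exact hz
  obtain ⟨t, ht, htz⟩ := hsurjφ _ hz'
  have h := hsi (fun _ => t) ((hmem _).2 ht)
  rw [hint t ht, hφ' t, mul_div_cancel_right₀ _ (abs_ne_zero.2 (hne t ht)), ← hφ t, htz] at h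
  rw [KZ.eq_const_apply_zero z]
  exact h

/-! ## The stub -/

/-- **Stub `stub_branchRealise`** — RULE 2 ALONG THE TWO HALVES OF THE BRANCH.  A representation `r`
on `{z | e < z 0}` and a representation `R` on `(0,1)` whose integrand is `½ r(x(t)) x′(t)` on
`(0, ½)` and `½ r(x(t)) (−x′(t))` on `(½, 1)`, `x(t) = e + t²(1 − t)²/(t − ½)²`,
`x′(t) = t(1 − t)(1 − 2t)(t² − t + ½)/(t − ½)⁴` (increasing onto `(e, ∞)` on the first half,
decreasing on the second), differ by an element of `M₁` (split at `½`, `helper_cells_1` on each half,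
rule 1b). [cite: KontsevichZagier2001, §1.2 rules (1), (2)] -/
theorem stub_branchRealise : ∀ (e : ℝ), IsAlgebraic ℚ e →
    ∀ (r R : KZ.IntegralRep 1), r.domain = {z | e < z 0} → R.domain = {z | z 0 ∈ Set.Ioo (0 : ℝ) 1} →
    (∀ t ∈ Set.Ioo (0 : ℝ) (1 / 2), R.integrand (fun _ => t) =
      1 / 2 * (r.integrand (fun _ => e + (t * (1 - t)) ^ 2 / (t - 1 / 2) ^ 2) *
        (t * (1 - t) * (1 - 2 * t) * (t ^ 2 - t + 1 / 2) / (t - 1 / 2) ^ 4))) →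
    (∀ t ∈ Set.Ioo (1 / 2 : ℝ) 1, R.integrand (fun _ => t) =
      1 / 2 * (r.integrand (fun _ => e + (t * (1 - t)) ^ 2 / (t - 1 / 2) ^ 2) *
        -(t * (1 - t) * (1 - 2 * t) * (t ^ 2 - t + 1 / 2) / (t - 1 / 2) ^ 4))) →
    KZ.of r - KZ.of R ∈ M₁ := by
  intro e he r R hr hR hRl hRr
  have hmemR : ∀ p : Fin 1 → ℝ, p ∈ R.domain ↔ p 0 ∈ Ioo (0 : ℝ) 1 := fun p => by rw [hR]; rfl
  -- rule 1a: the two halves of `R`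
  set R₁ := R.restrict (R.domain ∩ {z | z 0 < 1 / 2}) (R.isSemialgebraic_domain.inter branchChart_isSemialgebraic_lt_half)
    inter_subset_left with hR₁def
  set R₂ := R.restrict (R.domain ∩ {z | 1 / 2 < z 0}) (R.isSemialgebraic_domain.inter branchChart_isSemialgebraic_half_lt)
    inter_subset_left with hR₂def
  have hmem₁ : ∀ p : Fin 1 → ℝ, p ∈ R₁.domain ↔ p 0 ∈ Ioo (0 : ℝ) (1 / 2) := fun p => by
    rw [hR₁def, KZ.IntegralRep.domain_restrict, mem_inter_iff, hmemR]
    exact ⟨fun h => ⟨h.1.1, h.2⟩, fun h => ⟨⟨h.1, lt_trans h.2 (by norm_num : (1 / 2 : ℝ) < 1)⟩, h.2⟩⟩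
  have hmem₂ : ∀ p : Fin 1 → ℝ, p ∈ R₂.domain ↔ p 0 ∈ Ioo (1 / 2 : ℝ) 1 := fun p => by
    rw [hR₂def, KZ.IntegralRep.domain_restrict, mem_inter_iff, hmemR]
    exact ⟨fun h => ⟨h.2, h.1.2⟩, fun h => ⟨⟨lt_trans (by norm_num : (0 : ℝ) < 1 / 2) h.1, h.2⟩, h.1⟩⟩
  have hsplit : KZ.of R - KZ.of R₁ - KZ.of R₂ ∈ M₁ := by
    refine HomotopyInvariance.of_sub_sub_mem_of_cover R R₁ R₂ inter_subset_left inter_subset_left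
      (fun _ _ => rfl) (fun _ _ => rfl) ?_ ?_
    · refine measure_mono_null (fun z hz => ?_) measure_empty
      exact (lt_irrefl _ ((((hmem₁ z).1 hz.1).2).trans (((hmem₂ z).1 hz.2).1))).elim
    · refine measure_mono_null (fun z hz => ?_) (KZ.volume_setOf_last_eq_zero (n := 0) (1 / 2))
      obtain ⟨hzR, hzU⟩ := hz
      have h01 := (hmemR z).1 hzR
      show z 0 = 1 / 2
      by_contra hne
      rcases lt_or_gt_of_ne hne with h | h
      · exact hzU (Or.inl ((hmem₁ z).2 ⟨h01.1, h⟩))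
      · exact hzU (Or.inr ((hmem₂ z).2 ⟨h, h01.2⟩))
  -- rule 2 on each half
  obtain ⟨s₁, hs₁d, hs₁i, hrel₁⟩ := branchRealise_half he r R₁ (Ioo 0 (1 / 2)) hr hmem₁ (fun t ht => ht.2.ne)
    (fun t ht => (branchChart_deriv_pos ht).ne') (strictMonoOn_branchChart e).injOn
    (fun t ht => branchChart_gt e ⟨ht.1, ht.2.trans (by norm_num : (1 / 2 : ℝ) < 1)⟩ ht.2.ne)
    (fun u hu => exists_branchChart_eq e hu) fun t ht => by
      show R.integrand (fun _ => t) = _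
      rw [hRl t ht, abs_of_pos (branchChart_deriv_pos ht)]
      ring
  obtain ⟨s₂, hs₂d, hs₂i, hrel₂⟩ := branchRealise_half he r R₂ (Ioo (1 / 2) 1) hr hmem₂ (fun t ht => ht.1.ne')
    (fun t ht => (branchChart_deriv_neg ht).ne) (strictAntiOn_branchChart e).injOn
    (fun t ht => branchChart_gt e ⟨lt_trans (by norm_num : (0 : ℝ) < 1 / 2) ht.1, ht.2⟩ ht.1.ne')
    (fun u hu => exists_branchChart_eq' e hu) fun t ht => by
      show R.integrand (fun _ => t) = _
      rw [hRr t ht, abs_of_neg (branchChart_deriv_neg ht)]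
      ring
  -- rule 1b: `r = ½ r + ½ r` on `{z | e < z 0}`
  have hadd : KZ.of r - KZ.of s₁ - KZ.of s₂ ∈ M₁ := by
    refine HomotopyInvariance.integrandAddRel_subset ⟨1, r, s₁, s₂, hs₁d, hs₂d, fun z hz => ?_, rfl⟩
    show r.integrand z = s₁.integrand z + s₂.integrand z
    rw [hs₁i z hz, hs₂i z hz]
    ring
  have e₀ : KZ.of r - KZ.of R = (KZ.of r - KZ.of s₁ - KZ.of s₂) - (KZ.of R - KZ.of R₁ - KZ.of R₂) -
      ((KZ.of R₁ - KZ.of s₁) + (KZ.of R₂ - KZ.of s₂)) := by abel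
  rw [e₀]
  exact M₁.sub_mem (M₁.sub_mem hadd hsplit) (M₁.add_mem hrel₁ hrel₂)

end Summit.KontsevichZagierPeriods.SymplecticScissors.RealOnePeriodRelations.LoopLayer

end
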